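import Mathlib
import HarnessLib
import Summits.CriticalPhenomena.PercolationContinuityZ3.Theses.PercTreeValue
import Summits.CriticalPhenomena.PercolationContinuityZ3.Theorems.PercTreeValueTetrahedronDisjointCoexistenceStubTiledShell
import Literature.Probability.Percolation.LatticeWalksGM
import Literature.Probability.Percolation.PlanarDuality
import Literature.Probability.Percolation.RSW

/-!
# `stub_tiledShellAspect` of line `Sketch` (crux `TetrahedronDisjointCoexistence`,
# stmt-CriticalPhenomena-7798): the tiled closed shell with tiles of ARBITRARY aspect

Registered stub `stub_tiledShellAspect` (T1', rev c3) of the lead's skeleton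
`Cruxes/TetrahedronDisjointCoexistence/Lines/Sketch.lean`, landed DEF-FREE over tree declarations.
It is the landed `stub_tiledShell` (tiles `v + B(s) ⊆ v + B(2s)`, aspect `2`) with the outer tile
radius freed: tiles `v + B(s) ⊆ v + B(t)`, any `s ≤ t`.

Fix `p`, radii `s ≤ t` and `c ≥ 0` with `P_p(A(s,t)) ≤ 1 - c`, where `A(s,t)` is the annulus-crossing
event "some vertex of `B(s)` is joined inside `B(t)` to a vertex of `∂ⁱⁿB(t)`" (for `t = 2s` the event
of `PercAnnulusCrossing.CritAnnulusNonCrossing`; for `t = 4s` its aspect-`4` form). Let `R, R'` be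
vertex sets of `ℤ³` and `J` a finite set of tile centres such that every vertex `u ∈ R' ∖ R` adjacent
to `R` lies in a tile `v + B(s)`, `v ∈ J`, with room: every lattice neighbour of `v + B(t)` lies in
`R'`. Then `c ^ |J| ≤ P_p(Shell(R, R'))`, `Shell(R, R')` = "no open path of `R' ∖ R` from a vertex
adjacent to `R` to a vertex adjacent to `R'ᶜ`".

Why it is wanted. With `t = 4s` it turns the numerically measurable aspect-`4` form of X_B
(`P_{p_c}(B(n) ↔ ∂B(4n) in B(4n)) ≤ 1 - c₄`, MC `c₄ ≈ 1.7·10⁻³` flat in `n = 4…48`, Numerics-Sketch-c1)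
into closed shells of any bounded geometry, in particular into X_B itself
(`stub_annulusNonCrossing_of_aspectFour`, separate file): the aspect ratio of
`CritAnnulusNonCrossing` (stmt-CriticalPhenomena-0846) is immaterial.

Proof = the proof of `stub_tiledShell` verbatim with `box 3 t` for `box 3 (2 * s)`:
translation invariance (`bondPercolation_real_preimage_shift` through the relabelling transport
`shiftBoxCrossing_relabel_shift_mem_openConnIn_iff`), the pointwise clipping of a shell crossing at
its first visit to sup-distance `t` from the tile centre (`exists_openConnIn_le_level`; the
sup-distance lemmas `tiledShell_*` of the aspect-2 file are reused), and Harris–FKG for the finitely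
many decreasing complements (`sixWalls_prod_real_le_biInter`).
-/

noncomputable section

namespace Summit.CriticalPhenomena.PercolationContinuityZ3.Theorems.TetrahedronDisjointCoexistence

open MeasureTheory
open Literature.Probability.Percolation Literature.Probability.LatticeModels

/-! ### Translation of the aspect-general annulus-crossing event -/

/-- The translated aspect-general annulus-crossing event is the preimage of the centred one under
the shift of configurations `ω ↦ ω - v`. -/
theorem tiledShellAspect_event_eq (v : Site 3) (s t : ℕ) :
    {ω : BondConfig (Site 3) | ∃ x : Site 3, x - v ∈ box 3 s ∧ ∃ y : Site 3,
        y - v ∈ box 3 t ∧ (∃ z : Site 3, z - v ∉ box 3 t ∧ (zdGraph 3).Adj y z) ∧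
          ω ∈ openConnIn {u : Site 3 | u - v ∈ box 3 t} x y} =
      BondConfig.relabel (sym2Equiv (Site.shift (-v))) ⁻¹'
        {ω | ∃ x ∈ box 3 s, ∃ y ∈ innerBoundary (zdGraph 3) (box 3 t),
          ω ∈ openConnIn ↑(box 3 t) x y} := by
  ext ω
  simp only [Set.mem_setOf_eq, Set.mem_preimage]
  constructor
  · rintro ⟨x, hx, y, hy, ⟨z, hz, hyz⟩, hω⟩
    refine ⟨x - v, hx, y - v, ?_, ?_⟩
    · rw [mem_innerBoundary_iff]
      refine ⟨hy, z - v, hz, ?_⟩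
      have h := (zdGraph_adj_shift_iff (-v) y z).2 hyz
      simp only [Site.shift_apply, ← sub_eq_add_neg] at h
      exact h
    · rw [shiftBoxCrossing_relabel_shift_mem_openConnIn_iff, sub_add_cancel, sub_add_cancel]
      exact hω
  · rintro ⟨x', hx', y', hy', hω⟩
    rw [mem_innerBoundary_iff] at hy'
    obtain ⟨hy'mem, z', hz', hadj⟩ := hy'
    rw [shiftBoxCrossing_relabel_shift_mem_openConnIn_iff] at hω
    refine ⟨x' + v, ?_, y' + v, ?_, ⟨z' + v, ?_, ?_⟩, hω⟩
    · rwa [add_sub_cancel_right]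
    · rwa [add_sub_cancel_right]
    · rwa [add_sub_cancel_right]
    · have h := (zdGraph_adj_shift_iff v y' z').2 hadj
      simp only [Site.shift_apply] at h
      exact h

/-- Translation invariance of `P_p` for the aspect-general annulus-crossing event: the event
"some vertex of `v + B(s)` is joined inside `v + B(t)` to a vertex of `v + B(t)` adjacent to its
complement" has the probability of the centred event `A(s,t)`. -/
theorem tiledShellAspect_real_event_eq (p : unitInterval) (v : Site 3) (s t : ℕ) :
    (bondPercolation (zdGraph 3) p).real
        {ω : BondConfig (Site 3) | ∃ x : Site 3, x - v ∈ box 3 s ∧ ∃ y : Site 3,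
          y - v ∈ box 3 t ∧ (∃ z : Site 3, z - v ∉ box 3 t ∧ (zdGraph 3).Adj y z) ∧
            ω ∈ openConnIn {u : Site 3 | u - v ∈ box 3 t} x y} =
      (bondPercolation (zdGraph 3) p).real
        {ω | ∃ x ∈ box 3 s, ∃ y ∈ innerBoundary (zdGraph 3) (box 3 t),
          ω ∈ openConnIn ↑(box 3 t) x y} := by
  rw [tiledShellAspect_event_eq v s t]
  exact bondPercolation_real_preimage_shift (-v) p _

/-! ### The translated events: monotone, measurable, probability of the complement -/

/-- The translated aspect-general annulus-crossing event `E_v` is increasing. -/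
theorem tiledShellAspect_isUpperSet_event (v : Site 3) (s t : ℕ) :
    IsUpperSet {ω : BondConfig (Site 3) | ∃ x : Site 3, x - v ∈ box 3 s ∧ ∃ y : Site 3,
        y - v ∈ box 3 t ∧ (∃ z : Site 3, z - v ∉ box 3 t ∧ (zdGraph 3).Adj y z) ∧
          ω ∈ openConnIn {u : Site 3 | u - v ∈ box 3 t} x y} := by
  rintro ω ω' hle ⟨x, hx, y, hy, hz, hω⟩
  exact ⟨x, hx, y, hy, hz, isUpperSet_openConnIn _ x y hle hω⟩

/-- The translated aspect-general annulus-crossing event `E_v` is measurable. -/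
theorem tiledShellAspect_measurableSet_event (v : Site 3) (s t : ℕ) :
    MeasurableSet {ω : BondConfig (Site 3) | ∃ x : Site 3, x - v ∈ box 3 s ∧ ∃ y : Site 3,
        y - v ∈ box 3 t ∧ (∃ z : Site 3, z - v ∉ box 3 t ∧ (zdGraph 3).Adj y z) ∧
          ω ∈ openConnIn {u : Site 3 | u - v ∈ box 3 t} x y} := by
  have h : {ω : BondConfig (Site 3) | ∃ x : Site 3, x - v ∈ box 3 s ∧ ∃ y : Site 3,
        y - v ∈ box 3 t ∧ (∃ z : Site 3, z - v ∉ box 3 t ∧ (zdGraph 3).Adj y z) ∧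
          ω ∈ openConnIn {u : Site 3 | u - v ∈ box 3 t} x y} =
      ⋃ x : Site 3, ⋃ y : Site 3, ⋃ (_ : x - v ∈ box 3 s ∧ y - v ∈ box 3 t ∧
          (∃ z : Site 3, z - v ∉ box 3 t ∧ (zdGraph 3).Adj y z)),
        (openConnIn {u : Site 3 | u - v ∈ box 3 t} x y : Set (BondConfig (Site 3))) := by
    ext ω
    simp only [Set.mem_setOf_eq, Set.mem_iUnion, exists_prop]
    constructor
    · rintro ⟨x, hx, y, hy, hz, hω⟩
      exact ⟨x, y, ⟨hx, hy, hz⟩, hω⟩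
    · rintro ⟨x, y, ⟨hx, hy, hz⟩, hω⟩
      exact ⟨x, hx, y, hy, hz, hω⟩
  rw [h]
  exact MeasurableSet.iUnion fun x => MeasurableSet.iUnion fun y =>
    MeasurableSet.iUnion fun _ => restrictProduct_measurableSet_openConnIn _ x y

/-- `P(E_vᶜ) ≥ c` whenever `P(A(s,t)) ≤ 1 - c` (translation invariance). -/
theorem tiledShellAspect_le_real_compl_event (p : unitInterval) (s t : ℕ) (c : ℝ)
    (hXB : (bondPercolation (zdGraph 3) p).real
        {ω | ∃ x ∈ box 3 s, ∃ y ∈ innerBoundary (zdGraph 3) (box 3 t),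
          ω ∈ openConnIn ↑(box 3 t) x y} ≤ 1 - c) (v : Site 3) :
    c ≤ (bondPercolation (zdGraph 3) p).real
        {ω : BondConfig (Site 3) | ∃ x : Site 3, x - v ∈ box 3 s ∧ ∃ y : Site 3,
          y - v ∈ box 3 t ∧ (∃ z : Site 3, z - v ∉ box 3 t ∧ (zdGraph 3).Adj y z) ∧
            ω ∈ openConnIn {u : Site 3 | u - v ∈ box 3 t} x y}ᶜ := by
  rw [probReal_compl_eq_one_sub (tiledShellAspect_measurableSet_event v s t),
    tiledShellAspect_real_event_eq p v s t]
  linarith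

/-! ### The pointwise heart: a shell crossing realises a translated event -/

/-- **Pointwise.** On a lattice configuration `ω ⊆ E(ℤ³)`, an open path of `R' ∖ R` from a vertex
`u` adjacent to `R` to a vertex `w` adjacent to `R'ᶜ` realises, for the tile centre `v ∈ J`
covering `u`, the translated event `E_v`: `w ∉ v + B(t)` (every neighbour of `v + B(t)` lies in
`R'`), so the path clipped at its first visit to sup-distance `t` from `v` joins `u ∈ v + B(s)`
(`s ≤ t`) inside `v + B(t)` to a vertex with a neighbour outside `v + B(t)`. -/
theorem tiledShellAspect_event_of_openConnIn {s t : ℕ} (hst : s ≤ t) (R R' : Set (Site 3))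
    (J : Finset (Site 3))
    (hcover : ∀ u ∈ R' \ R, (∃ z ∈ R, (zdGraph 3).Adj u z) →
      ∃ v ∈ J, u - v ∈ box 3 s ∧
        ∀ y : Site 3, y - v ∈ box 3 t → ∀ z : Site 3, (zdGraph 3).Adj y z → z ∈ R')
    {ω : BondConfig (Site 3)} (hω : ω ⊆ (zdGraph 3).edgeSet) {u w : Site 3} (hu : u ∈ R' \ R)
    (huz : ∃ z ∈ R, (zdGraph 3).Adj u z) (hwz : ∃ z ∉ R', (zdGraph 3).Adj w z)
    (hconn : ω ∈ openConnIn (R' \ R) u w) :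
    ∃ v ∈ J, ω ∈ {ω : BondConfig (Site 3) | ∃ x : Site 3, x - v ∈ box 3 s ∧ ∃ y : Site 3,
        y - v ∈ box 3 t ∧ (∃ z : Site 3, z - v ∉ box 3 t ∧ (zdGraph 3).Adj y z) ∧
          ω ∈ openConnIn {u : Site 3 | u - v ∈ box 3 t} x y} := by
  obtain ⟨v, hvJ, huv, hroom⟩ := hcover u hu huz
  refine ⟨v, hvJ, ?_⟩
  -- `w ∉ v + B(t)`: otherwise its neighbour outside `R'` would lie in `R'`
  have hw : w - v ∉ box 3 t := by
    intro hin
    obtain ⟨z', hz', hwz'⟩ := hwz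
    exact hz' (hroom w hin z' hwz')
  -- clip the path at its first visit to sup-distance `t` from `v`
  have hst' : (s : ℤ) ≤ (t : ℤ) := by exact_mod_cast hst
  have hx : max (max |u 0 - v 0| |u 1 - v 1|) |u 2 - v 2| ≤ (t : ℤ) :=
    le_trans (tiledShell_supDist_le_of_mem_box huv) hst'
  have hy : (t : ℤ) ≤ max (max |w 0 - v 0| |w 1 - v 1|) |w 2 - v 2| :=
    (tiledShell_lt_supDist_of_not_mem_box hw).le
  obtain ⟨y, hyf, hconn'⟩ := exists_openConnIn_le_level hω
    (fun x : Site 3 => max (max |x 0 - v 0| |x 1 - v 1|) |x 2 - v 2|)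
    (tiledShell_supDist_le_of_adj v) (t : ℤ) hx hy hconn
  have hsub : (R' \ R) ∩ {z : Site 3 | max (max |z 0 - v 0| |z 1 - v 1|) |z 2 - v 2| ≤ (t : ℤ)} ⊆
      {u : Site 3 | u - v ∈ box 3 t} := fun z hz => tiledShell_mem_box_of_supDist_le hz.2
  exact ⟨u, huv, y, tiledShell_mem_box_of_supDist_le hyf.le, tiledShell_exit_of_supDist_eq hyf,
    openConnIn_mono hsub u y hconn'⟩

/-! ### The stub -/

/-- **T1' — the tiled closed shell, tiles of arbitrary aspect.** Fix `p`, radii `s ≤ t` and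
`c ≥ 0` with `P_p(A(s,t)) ≤ 1 − c`, `A(s,t)` = "some vertex of `B(s)` is joined inside `B(t)` to a
vertex of `∂ⁱⁿB(t)`". Let `R, R'` be vertex sets and `J` a finite set of tile centres such that every
vertex `u ∈ R' ∖ R` adjacent to `R` lies in a tile `v + B(s)`, `v ∈ J`, with room: every lattice
neighbour of `v + B(t)` lies in `R'`. Then `c ^ |J| ≤ P_p(Shell(R, R'))`, `Shell(R, R')` = no open
path of `R' ∖ R` from a vertex adjacent to `R` to a vertex adjacent to `R'ᶜ`. (For `t = 2s` this is
the landed `stub_tiledShell`.) Proof: a.e. `⋂_{v ∈ J} E_vᶜ ⊆ Shell(R, R')`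
(`tiledShellAspect_event_of_openConnIn`, `sixWalls_real_mono_of_subset_edgeSet`); the `E_v` are
increasing and measurable with `P(E_vᶜ) ≥ c` (`tiledShellAspect_le_real_compl_event`), and
Harris–FKG for the `|J|` decreasing complements (`sixWalls_prod_real_le_biInter`). -/
theorem stub_tiledShellAspect (p : unitInterval) {s t : ℕ} (hst : s ≤ t) (c : ℝ) (hc : 0 ≤ c)
    (hXB : (bondPercolation (zdGraph 3) p).real
        {ω | ∃ x ∈ box 3 s, ∃ y ∈ innerBoundary (zdGraph 3) (box 3 t),
          ω ∈ openConnIn ↑(box 3 t) x y} ≤ 1 - c)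
    (R R' : Set (Site 3)) (J : Finset (Site 3))
    (hcover : ∀ u ∈ R' \ R, (∃ z ∈ R, (zdGraph 3).Adj u z) →
      ∃ v ∈ J, u - v ∈ box 3 s ∧
        ∀ y : Site 3, y - v ∈ box 3 t → ∀ z : Site 3, (zdGraph 3).Adj y z → z ∈ R') :
    c ^ J.card ≤ (bondPercolation (zdGraph 3) p).real
        {ω | ∀ u ∈ R' \ R, ∀ w ∈ R' \ R, (∃ z ∈ R, (zdGraph 3).Adj u z) → (∃ z ∉ R', (zdGraph 3).Adj w z) →
          ω ∉ openConnIn (R' \ R) u w} := by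
  -- the translated events
  set E : Site 3 → Set (BondConfig (Site 3)) := fun v =>
    {ω : BondConfig (Site 3) | ∃ x : Site 3, x - v ∈ box 3 s ∧ ∃ y : Site 3,
      y - v ∈ box 3 t ∧ (∃ z : Site 3, z - v ∉ box 3 t ∧ (zdGraph 3).Adj y z) ∧
        ω ∈ openConnIn {u : Site 3 | u - v ∈ box 3 t} x y} with hE
  calc c ^ J.card = ∏ _v ∈ J, c := (Finset.prod_const c).symm
    _ ≤ ∏ v ∈ J, (bondPercolation (zdGraph 3) p).real (E v)ᶜ :=
        Finset.prod_le_prod (fun _ _ => hc) fun v _ => tiledShellAspect_le_real_compl_event p s t c hXB v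
    _ ≤ (bondPercolation (zdGraph 3) p).real (⋂ v ∈ J, (E v)ᶜ) :=
        sixWalls_prod_real_le_biInter (zdGraph 3) p J
          (fun v _ => (tiledShellAspect_isUpperSet_event v s t).compl)
          (fun v _ => (tiledShellAspect_measurableSet_event v s t).compl)
    _ ≤ _ := by
        refine sixWalls_real_mono_of_subset_edgeSet (zdGraph 3) p fun ω hω hmem => ?_
        intro u hu w _ huz hwz hconn
        obtain ⟨v, hvJ, hv⟩ :=
          tiledShellAspect_event_of_openConnIn hst R R' J hcover hω hu huz hwz hconn
        exact (Set.mem_iInter₂.1 hmem v hvJ) hv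

end Summit.CriticalPhenomena.PercolationContinuityZ3.Theorems.TetrahedronDisjointCoexistence

end
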